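import Summits.CriticalPhenomena.PercolationContinuityZ3.Theorems.PercNearOneGluingNoHeavyQuantSubproductMixture
import HarnessLib

/-!
# QUANT lane R8, T-DEC: THE CYCLIC BOOST CERTIFICATE — three siblings with a COMMON opened mean and floor but ARBITRARY root gates whose
# pairwise sums are at most `1` (and arbitrary, different sub-trees) satisfy the sibling step at the TRUE floor, GIVEN the oracle

builds on p205010 (kernel theorem, internal audit signed; external expert review pending)

Support file (`--supports stmt-CriticalPhenomena-4575`), QUANT lane seat prim-quant-census-1 (gen 26), rung R8 of
`run/shared/lean/prim/quant/LADDER.md`; memo `run/shared/lean/prim/quant/prim-quant-census-1/g26/SIZEBIAS-G26.md` §8–§9.  Theorems only, standard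
axioms, no sorries.  An INSTANCE of ✓ `…QuantSubproductMixture` (`sdec_flaw_of_subproductMix`, p503068); it contains arm-1 g53's symmetric triple
(✓ p503171 `sdec_symTriple_trueFloor`, identical siblings, `2q ≤ 1`) as the diagonal `q₀ = q₁ = q₂`.

THE CERTIFICATE (found as a FIXED support of the exact LP on 120 random gate triples, then in closed form; memo §9).  Siblings `0,1,2` with gates
`qᵢ`, common opened mean `m` and floor `x₁`; indices mod 3.  Seven components:
* `Q_c` (c = 0,1,2): DROP sibling `c` and BOOST sibling `c+1` to openness `q_{c+1} + q_c` (sibling `c+2` keeps `q_{c+2}`) — gated mean exactly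
  `(q₀+q₁+q₂)m = fmean`; weight `u_c = q_{c+1} q_{c+2} (1−q_c)(1−q_{c+1})·[q_c(1−q_{c+1}−q_{c+2})(1−q_c−q_{c+2}) + (1−q_{c+2})(q_{c+1}+q_{c+2})] / Δ`;
* `O_c` (c = 0,1,2): the PAIR `{c+1, c+2}` fully opened; weight
  `w_c = q_c q_{c+1} q_{c+2} (1−q_c)(1−q_c−q_{c+2})·[(q_c+q_{c+1})(q_{c+1}+q_{c+2})(1−q_{c+1})(1−q_{c+2}) − q_c q_{c+2}(1−q_{c+1}−q_{c+2})] / Δ`;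
* `O₃`: the fully opened triple, weight `q₀q₁q₂`;
with `Δ = q₀q₁q₂(1−q₁−q₂)(1−q₂−q₀)(1−q₀−q₁) + (q₀+q₁)(q₁+q₂)(q₂+q₀)(1−q₀)(1−q₁)(1−q₂) > 0`.  The weights solve the (cyclic, two-term) singleton equations
`(q_a + q_{a−1})(1−q_{a+1})·u_{a−1} + q_a(1−q_{a+1}−q_{a−1})·u_{a+1} = q_a(1−q_{a+1})(1−q_{a−1})` by Cramer and are MANIFESTLY nonnegative when every
pairwise gate sum is `≤ 1` (the bracket of `w_c` is `XY − xy` with `X ≥ x ≥ 0`, `Y ≥ y ≥ 0`).  PATTERN IDENTITY (`cyclicTriple_pattern`):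
`Σ_c u_c P_c(A) = Π_{i∈A} qᵢ Π_{i∉A}(1−qᵢ)` on the seven non-empty patterns (`simp` + `field_simp`/`ring` after clearing `Δ`).  Floors: the boosted
components keep every openness `≥` the original gate (floor bound `v = x` works with mean exactly `fmean`); the open pairs/triple use `v = x₁`
(`|B|·x ≤ (Σq)·x₁` from `x ≤ qᵢx₁`).  CENSUS (memo §8): with equal means the boosted dictionary is feasible for a gate triple IFF its two largest gates sum
to `≤ 1` (240/240 vs 160/160) — so the hypothesis is the exact reach of this dictionary.

* **`sdec_flaw_cyclicTriple_of_oracle`**: `0 < x < 1`; `s₀ s₁ s₂` tree-built at `x` (`Sib.TreeOK x`) with `s₁.mean = s₀.mean = s₂.mean`, `s₁.x₁ = s₀.x₁ = s₂.x₁`;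
  `s₀.q + s₁.q ≤ 1`, `s₁.q + s₂.q ≤ 1`, `s₀.q + s₂.q ≤ 1`; the oracle below `fgates [s₀,s₁,s₂]` ⟹ `SDEC x (ftop [s₀,s₁,s₂]) (flaw [s₀,s₁,s₂])`.

HONEST STATUS.  A width-3 sub-family of the open core; `SiblingStep` ⟺ `GateStepN`, `UPartStep`, `LightResidDECOracle`, `FarTreeRow` remain OPEN; RATE class
(log\*) and the honest sentence of `run/shared/lean/prim/quant/README.md` unchanged.  [this work]; nothing here is cited as a published result.  The gluing
rows served [cite: KozmaNitzan2024, Conjecture 3 (p. 15)]; product measure [cite: Grimmett1999, §1.3 p. 10].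
-/

noncomputable section

open scoped BigOperators

namespace Summit.CriticalPhenomena.PercolationContinuityZ3.Theorems
namespace Quant
namespace LawDec

open Finset

/-- **the pattern identity of the cyclic boost certificate** (numerators; `Δ` cleared): for gates `a, b, c` of siblings `0, 1, 2` and every non-empty
`A ⊆ {0,1,2}`, `Σ_k N_k·P_k(A) = Δ·Π_{i∈A} qᵢ Π_{i∉A} (1−qᵢ)` with the seven components of the module docstring. [this work] -/
theorem cyclicTriple_pattern (a b c : ℝ) (A : Finset (Fin 3)) (hA : A.Nonempty) :
    let Δ : ℝ := a * b * c * (1 - b - c) * (1 - c - a) * (1 - a - b) + (a + b) * (b + c) * (c + a) * (1 - a) * (1 - b) * (1 - c)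
    ∑ k : Fin 7,
      (![b * c * (1 - a) * (1 - b) * (a * (1 - b - c) * (1 - a - c) + (1 - c) * (b + c)),
          c * a * (1 - b) * (1 - c) * (b * (1 - c - a) * (1 - b - a) + (1 - a) * (c + a)),
          a * b * (1 - c) * (1 - a) * (c * (1 - a - b) * (1 - c - b) + (1 - b) * (a + b)),
          a * b * c * (1 - a) * (1 - a - c) * ((a + b) * (b + c) * (1 - b) * (1 - c) - a * c * (1 - b - c)),
          a * b * c * (1 - b) * (1 - b - a) * ((b + c) * (c + a) * (1 - c) * (1 - a) - b * a * (1 - c - a)),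
          a * b * c * (1 - c) * (1 - c - b) * ((c + a) * (a + b) * (1 - a) * (1 - b) - c * b * (1 - a - b)),
          a * b * c * Δ] : Fin 7 → ℝ) k *
        (if A ⊆ (![{1, 2}, {2, 0}, {0, 1}, {1, 2}, {2, 0}, {0, 1}, {0, 1, 2}] : Fin 7 → Finset (Fin 3)) k then
          (∏ i ∈ A, (![fun l => if l = (1 : Fin 3) then b + a else c, fun l => if l = (2 : Fin 3) then c + b else a,
              fun l => if l = (0 : Fin 3) then a + c else b, fun _ => 1, fun _ => 1, fun _ => 1, fun _ => 1] : Fin 7 → Fin 3 → ℝ) k i) *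
            ∏ i ∈ (![{1, 2}, {2, 0}, {0, 1}, {1, 2}, {2, 0}, {0, 1}, {0, 1, 2}] : Fin 7 → Finset (Fin 3)) k \ A,
              (1 - (![fun l => if l = (1 : Fin 3) then b + a else c, fun l => if l = (2 : Fin 3) then c + b else a,
                fun l => if l = (0 : Fin 3) then a + c else b, fun _ => 1, fun _ => 1, fun _ => 1, fun _ => 1] : Fin 7 → Fin 3 → ℝ) k i)
        else 0)
      = Δ * ((∏ i ∈ A, (![a, b, c] : Fin 3 → ℝ) i) * ∏ i ∈ (Finset.univ : Finset (Fin 3)) \ A, (1 - (![a, b, c] : Fin 3 → ℝ) i)) := by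
  intro Δ
  have hA' : A ≠ ∅ := Finset.nonempty_iff_ne_empty.1 hA
  have key : ∀ B : Finset (Fin 3), B ≠ ∅ →
      B = {0} ∨ B = {1} ∨ B = {2} ∨ B = {0, 1} ∨ B = {0, 2} ∨ B = {1, 2} ∨ B = {0, 1, 2} := by decide
  have huniv : (Finset.univ : Finset (Fin 3)) = {0, 1, 2} := by decide
  rw [huniv]
  rcases key A hA' with rfl | rfl | rfl | rfl | rfl | rfl | rfl <;>
    simp (config := {decide := true}) [Fin.sum_univ_succ, Finset.sdiff_eq_filter, Finset.filter_insert,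
      Finset.filter_singleton, Finset.prod_insert, Finset.prod_singleton, Δ] <;> ring

/-- **THE CYCLIC BOOST TRIPLE (SDEC form, given the oracle).**  Three tree-built siblings at floor `x` with a common opened mean and a common
sub-forest floor, root gates with all pairwise sums `≤ 1`, and the oracle below `fgates [s₀,s₁,s₂]` ⟹ the forest is SDEC at `x` — by the sub-product
mixture criterion with the seven-component cyclic certificate (`cyclicTriple_pattern`). [this work] -/
theorem sdec_flaw_cyclicTriple_of_oracle {x : ℝ} (hx0 : 0 < x) (hx1 : x < 1) (s₀ s₁ s₂ : Sib)
    (h₀ : s₀.TreeOK x) (h₁ : s₁.TreeOK x) (h₂ : s₂.TreeOK x)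
    (hm₁ : s₁.mean = s₀.mean) (hm₂ : s₂.mean = s₀.mean) (hy₁ : s₁.x₁ = s₀.x₁) (hy₂ : s₂.x₁ = s₀.x₁)
    (h01 : s₀.q + s₁.q ≤ 1) (h12 : s₁.q + s₂.q ≤ 1) (h02 : s₀.q + s₂.q ≤ 1)
    (hO : ∀ (x' : ℝ) (n' M' : ℕ) (μ' : ℕ → ℝ), n' < fgates [s₀, s₁, s₂] → TreeBuiltN x' n' M' μ' → SDEC x' M' μ') :
    SDEC x (ftop [s₀, s₁, s₂]) (flaw [s₀, s₁, s₂]) := by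
  classical
  have hm0 : 0 < s₀.mean := s₀.mean_pos h₀
  have hL : ∀ t ∈ [s₀, s₁, s₂], t.TreeOK x := by
    intro t ht
    simp only [List.mem_cons, List.not_mem_nil, or_false] at ht
    rcases ht with rfl | rfl | rfl
    · exact h₀
    · exact h₁
    · exact h₂
  obtain ⟨ha0, ha1, hxa, hT₀, _⟩ := h₀
  obtain ⟨hb0, hb1, hxb, hT₁, _⟩ := h₁
  obtain ⟨hc0, hc1, hxc, hT₂, _⟩ := h₂
  obtain ⟨hy0, hy1', _, _, _, _⟩ := hT₀.lawFacts
  set a : ℝ := s₀.q with hadef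
  set b : ℝ := s₁.q with hbdef
  set c : ℝ := s₂.q with hcdef
  set m : ℝ := s₀.mean with hmdef
  set y : ℝ := s₀.x₁ with hydef
  have hmean : ∀ i : Fin [s₀, s₁, s₂].length, ([s₀, s₁, s₂].get i).mean = m := by
    intro i; fin_cases i
    · rfl
    · exact hm₁
    · exact hm₂
  have hfloor : ∀ i : Fin [s₀, s₁, s₂].length, ([s₀, s₁, s₂].get i).x₁ = y := by
    intro i; fin_cases i
    · rfl
    · exact hy₁
    · exact hy₂
  have hgate : ∀ i : Fin [s₀, s₁, s₂].length, ([s₀, s₁, s₂].get i).q = (![a, b, c] : Fin 3 → ℝ) i := by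
    intro i; fin_cases i <;> rfl
  have hxy : x ≤ a * y ∧ x ≤ b * y ∧ x ≤ c * y := ⟨hxa, by rw [← hy₁]; exact hxb, by rw [← hy₂]; exact hxc⟩
  obtain ⟨hxa', hxb', hxc'⟩ := hxy
  have hfm : fmean [s₀, s₁, s₂] = (a + b + c) * m := by
    simp only [fmean]; rw [hm₁, hm₂]; ring
  -- the determinant
  set Δ : ℝ := a * b * c * (1 - b - c) * (1 - c - a) * (1 - a - b) + (a + b) * (b + c) * (c + a) * (1 - a) * (1 - b) * (1 - c) with hΔ
  have hΔ0 : 0 < Δ := by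
    have h1 : 0 ≤ a * b * c * (1 - b - c) * (1 - c - a) * (1 - a - b) := by
      have := mul_nonneg (mul_nonneg (mul_nonneg (mul_nonneg (mul_nonneg ha0.le hb0.le) hc0.le) (by linarith : (0:ℝ) ≤ 1 - b - c))
        (by linarith : (0:ℝ) ≤ 1 - c - a)) (by linarith : (0:ℝ) ≤ 1 - a - b)
      exact this
    have h2 : 0 < (a + b) * (b + c) * (c + a) * (1 - a) * (1 - b) * (1 - c) := by positivity
    linarith
  -- the certificate data
  set N : Fin 7 → ℝ :=
    ![b * c * (1 - a) * (1 - b) * (a * (1 - b - c) * (1 - a - c) + (1 - c) * (b + c)),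
      c * a * (1 - b) * (1 - c) * (b * (1 - c - a) * (1 - b - a) + (1 - a) * (c + a)),
      a * b * (1 - c) * (1 - a) * (c * (1 - a - b) * (1 - c - b) + (1 - b) * (a + b)),
      a * b * c * (1 - a) * (1 - a - c) * ((a + b) * (b + c) * (1 - b) * (1 - c) - a * c * (1 - b - c)),
      a * b * c * (1 - b) * (1 - b - a) * ((b + c) * (c + a) * (1 - c) * (1 - a) - b * a * (1 - c - a)),
      a * b * c * (1 - c) * (1 - c - b) * ((c + a) * (a + b) * (1 - a) * (1 - b) - c * b * (1 - a - b)),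
      a * b * c * Δ] with hN
  set u : Fin 7 → ℝ := fun k => N k / Δ with hu
  set E : Fin 7 → Finset (Fin 3) := ![{1, 2}, {2, 0}, {0, 1}, {1, 2}, {2, 0}, {0, 1}, {0, 1, 2}] with hE
  set o : Fin 7 → Fin 3 → ℝ :=
    ![fun l => if l = (1 : Fin 3) then b + a else c, fun l => if l = (2 : Fin 3) then c + b else a,
      fun l => if l = (0 : Fin 3) then a + c else b, fun _ => 1, fun _ => 1, fun _ => 1, fun _ => 1] with ho
  set v : Fin 7 → ℝ := ![x, x, x, y, y, y, y] with hv
  -- nonnegativity of the numerators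
  have e1 : (0:ℝ) ≤ 1 - a - b := by linarith
  have e2 : (0:ℝ) ≤ 1 - b - c := by linarith
  have e3 : (0:ℝ) ≤ 1 - a - c := by linarith
  have e3' : (0:ℝ) ≤ 1 - c - a := by linarith
  have e1' : (0:ℝ) ≤ 1 - b - a := by linarith
  have e2' : (0:ℝ) ≤ 1 - c - b := by linarith
  have f1 : (0:ℝ) ≤ 1 - a := by linarith
  have f2 : (0:ℝ) ≤ 1 - b := by linarith
  have f3 : (0:ℝ) ≤ 1 - c := by linarith
  -- the `XY − xy` brackets, written as sums of nonnegative terms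
  have g0 : 0 ≤ (a + b) * (b + c) * (1 - b) * (1 - c) - a * c * (1 - b - c) := by
    have e : (a + b) * (b + c) * (1 - b) * (1 - c) - a * c * (1 - b - c)
        = (a + b) * (b + c) * (b * c) + b * (a + b + c) * (1 - b - c) := by ring
    rw [e]; exact add_nonneg (by positivity) (mul_nonneg (by positivity) e2)
  have g1 : 0 ≤ (b + c) * (c + a) * (1 - c) * (1 - a) - b * a * (1 - c - a) := by
    have e : (b + c) * (c + a) * (1 - c) * (1 - a) - b * a * (1 - c - a)
        = (b + c) * (c + a) * (c * a) + c * (a + b + c) * (1 - c - a) := by ring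
    rw [e]; exact add_nonneg (by positivity) (mul_nonneg (by positivity) e3')
  have g2 : 0 ≤ (c + a) * (a + b) * (1 - a) * (1 - b) - c * b * (1 - a - b) := by
    have e : (c + a) * (a + b) * (1 - a) * (1 - b) - c * b * (1 - a - b)
        = (c + a) * (a + b) * (a * b) + a * (a + b + c) * (1 - a - b) := by ring
    rw [e]; exact add_nonneg (by positivity) (mul_nonneg (by positivity) e1)
  have n0 : 0 ≤ b * c * (1 - a) * (1 - b) * (a * (1 - b - c) * (1 - a - c) + (1 - c) * (b + c)) :=
    mul_nonneg (by positivity) (add_nonneg (mul_nonneg (mul_nonneg ha0.le e2) e3) (by positivity))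
  have n1 : 0 ≤ c * a * (1 - b) * (1 - c) * (b * (1 - c - a) * (1 - b - a) + (1 - a) * (c + a)) :=
    mul_nonneg (by positivity) (add_nonneg (mul_nonneg (mul_nonneg hb0.le e3') e1') (by positivity))
  have n2 : 0 ≤ a * b * (1 - c) * (1 - a) * (c * (1 - a - b) * (1 - c - b) + (1 - b) * (a + b)) :=
    mul_nonneg (by positivity) (add_nonneg (mul_nonneg (mul_nonneg hc0.le e1) e2') (by positivity))
  have n3 : 0 ≤ a * b * c * (1 - a) * (1 - a - c) * ((a + b) * (b + c) * (1 - b) * (1 - c) - a * c * (1 - b - c)) :=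
    mul_nonneg (mul_nonneg (by positivity) e3) g0
  have n4 : 0 ≤ a * b * c * (1 - b) * (1 - b - a) * ((b + c) * (c + a) * (1 - c) * (1 - a) - b * a * (1 - c - a)) :=
    mul_nonneg (mul_nonneg (by positivity) e1') g1
  have n5 : 0 ≤ a * b * c * (1 - c) * (1 - c - b) * ((c + a) * (a + b) * (1 - a) * (1 - b) - c * b * (1 - a - b)) :=
    mul_nonneg (mul_nonneg (by positivity) e2') g2
  have n6 : 0 ≤ a * b * c * Δ := mul_nonneg (by positivity) hΔ0.le
  have hN0 : ∀ k, 0 ≤ N k := by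
    intro k
    fin_cases k
    exacts [n0, n1, n2, n3, n4, n5, n6]
  clear n0 n1 n2 n3 n4 n5 n6 g0 g1 g2
  -- gated means of the components
  have hmc : ∀ k, fmean (subRegate [s₀, s₁, s₂] (E k) (o k)) = (![(a + b + c) * m, (a + b + c) * m, (a + b + c) * m,
      2 * m, 2 * m, 2 * m, 3 * m] : Fin 7 → ℝ) k := by
    intro k
    rw [fmean_subRegate, Finset.sum_congr rfl fun i _ => by rw [hmean i]]
    fin_cases k <;> simp [hE, ho, Finset.sum_insert] <;> ring
  refine sdec_flaw_of_subproductMix hx0 hx1 [s₀, s₁, s₂] hL (by simp) hO (Finset.univ : Finset (Fin 7)) u E o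
    ?_ ?_ ?_ ?_ ?_ v ?_ ?_ ?_ ?_
  · intro k _; exact div_nonneg (hN0 k) hΔ0.le
  · intro k _ i _
    fin_cases k <;> fin_cases i <;> simp [ho] <;> linarith only [ha0, hb0, hc0]
  · intro k _ i _
    fin_cases k <;> fin_cases i <;> simp [ho] <;> linarith only [h01, h12, h02, ha1, hb1, hc1]
  · intro k _
    fin_cases k
    · exact ⟨0, Or.inl (show (0 : Fin 3) ∉ ({1, 2} : Finset (Fin 3)) by decide)⟩
    · exact ⟨1, Or.inl (show (1 : Fin 3) ∉ ({2, 0} : Finset (Fin 3)) by decide)⟩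
    · exact ⟨2, Or.inl (show (2 : Fin 3) ∉ ({0, 1} : Finset (Fin 3)) by decide)⟩
    · exact ⟨0, Or.inl (show (0 : Fin 3) ∉ ({1, 2} : Finset (Fin 3)) by decide)⟩
    · exact ⟨1, Or.inl (show (1 : Fin 3) ∉ ({2, 0} : Finset (Fin 3)) by decide)⟩
    · exact ⟨2, Or.inl (show (2 : Fin 3) ∉ ({0, 1} : Finset (Fin 3)) by decide)⟩
    · exact ⟨0, Or.inr rfl⟩
  · -- the pattern identity
    intro A hA
    have e : ((∏ i ∈ A, ([s₀, s₁, s₂].get i).q) * ∏ i ∈ Finset.univ \ A, (1 - ([s₀, s₁, s₂].get i).q))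
          = (∏ i ∈ A, (![a, b, c] : Fin 3 → ℝ) i) * ∏ i ∈ Finset.univ \ A, (1 - (![a, b, c] : Fin 3 → ℝ) i) := by
      simp only [hgate]
    rw [e]
    simp only [hu, div_mul_eq_mul_div, ← Finset.sum_div]
    rw [div_eq_iff hΔ0.ne']
    have hp := cyclicTriple_pattern a b c A hA
    simp only at hp
    rw [hN, hE, ho, hΔ]
    exact hp.trans (mul_comm _ _)
  · intro k _
    fin_cases k <;> simp [hv] <;> first | exact hx0 | exact hy0
  · intro k _ i _
    rw [hfloor i]
    have hay : 0 ≤ a * y := by positivity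
    have hby : 0 ≤ b * y := by positivity
    have hcy : 0 ≤ c * y := by positivity
    fin_cases k <;> simp [hv, ho] <;> (try split_ifs) <;> linarith only [hxa', hxb', hxc', hay, hby, hcy]
  · intro k _
    rw [hmc, hfm]
    have hs : 3 * x ≤ (a + b + c) * y := by linarith only [hxa', hxb', hxc']
    have hq1 : x * (2 * m) ≤ (a + b + c) * m * y := by nlinarith only [hs, hm0, hx0]
    have hq2 : x * (3 * m) ≤ (a + b + c) * m * y := by nlinarith only [hs, hm0, hx0]
    have hq0 : x * ((a + b + c) * m) ≤ (a + b + c) * m * x := le_of_eq (by ring)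
    fin_cases k <;> simp only [hv] <;> first | exact hq0 | exact hq1 | exact hq2
  · intro k _
    rw [hmc, hfm]
    have habc : a + b + c ≤ 2 := by linarith only [h01, hc1]
    have hp1 : (a + b + c) * m ≤ 2 * m := by nlinarith only [habc, hm0]
    have hp2 : (a + b + c) * m ≤ 3 * m := by nlinarith only [habc, hm0]
    fin_cases k <;> simp <;> first | exact hp1 | exact hp2

end LawDec
end Quant
end Summit.CriticalPhenomena.PercolationContinuityZ3.Theorems
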